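import Literature.NumberTheory.QuadraticFields.RealQuadraticFundamentalUnit
import Literature.NumberTheory.QuadraticFields.RealQuadraticUnits
import Literature.NumberTheory.QuadraticFields.FundamentalDiscriminant
import Mathlib.NumberTheory.Pell
import HarnessLib

/-!
# The regulator of a real quadratic field is the logarithm of the product of the complete
# quotients over the principal cycle

Topic `NumberTheory/QuadraticFields`, namespace `Literature.NumberTheory.QuadraticFields.Quadratic`
(abstract quadratic number fields `K`, as in `HeegnerCondition.lean`, `RealQuadraticUnits.lean`).
Theorem-only file (no definitions, no named facts). For a number field `K` of degree `2` with
positive discriminant `d_K` we prove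

* **`regulator_eq_log_fundUnit`**: `R_K = log ε`, where `ε = QuadIrr.fundUnit d_K = ∏_{k=1}^{p} φ_k`
  is the product of the complete quotients over the period of the continued fraction of
  `δ = (q + √d_K)/2` (`RealQuadraticPrincipalCycle.lean`), i.e. Mathlib's regulator of `K` is the
  regulator `R_Δ = log ε_Δ` of Jacobson–Williams (*Solving the Pell Equation*, §5.3 p. 112 and
  (5.33)–(5.34); §4.3 for `ε_Δ`), and
* **`regulator_eq_sum_log`**: `R_K = ∑_{k<p} log φ(ρᵏ x₁)` — the regulator is the total Shanks
  distance around the principal cycle (Jozsa 2003, §6.3 Thm. 4(b) with §7: `δ(J_i, ρJ_i) = ln γ_i`;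
  Jacobson–Williams §7.4), the form in which Hallgren's algorithm computes it;

together with `not_isSquare_discr_toNat` (`d_K` is not a square) used to run the cycle; and, in the
second part (in terms of a squarefree radicand `d ≥ 2`, `K ∋ √d`): the fundamental discriminant
`fundDiscr d ∈ {d, 4d}` with `discr_eq_fundDiscr : d_K = fundDiscr d`, the least unit-solution
`exists_isLeast_unitSol`, `regulator_eq_log_of_sq_eq_natCast` / `exists_regulator_eq_log`
(`R_K = log ε₀`, `ε₀` the least `(X + Y√D)/2 > 1` with `X² − DY² = ±4` — Jozsa's definition), and
`regulator_eq_log_fundUnit_fundDiscr` / `regulator_eq_sum_log_fundDiscr`. HISTORY: the second part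
restores (same names, same statements, new proofs) the interface of proposal p57716, which an
earlier version of this file (p60362) had replaced by accident — see the note at the head of that part. The proof
feeds the minimality `QuadIrr.fundUnit_le` and the unit `(G + B√d_K)/2 ↦ (G − tB)/2 + Bω` into
`regulator_eq_log_of_minimal` of `RealQuadraticUnits.lean`.

## References

* M. J. Jacobson, Jr., H. C. Williams, *Solving the Pell Equation*, CMS Books in Mathematics,
  Springer (2009), §4.3, §5.3 (p. 112, (5.33)–(5.34)), §7.4. [JacobsonWilliams2008]
* R. Jozsa, *Notes on Hallgren's efficient quantum algorithm for solving Pell's equation*,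
  arXiv:quant-ph/0302134 (2003), §3 (R = ln ε₀), §6.3 Thm. 4, §7. [Jozsa2003]
-/

noncomputable section

open Module NumberField NumberField.InfinitePlace NumberField.Units

namespace Literature.NumberTheory.QuadraticFields.Quadratic

variable {K : Type*} [Field K] [NumberField K]

/-- The discriminant of a real quadratic field, as a natural number, is not a square (it is a
fundamental discriminant `> 1`). [folklore] -/
theorem not_isSquare_discr_toNat (h2 : finrank ℚ K = 2) (hd : 0 < NumberField.discr K) :
    ¬ IsSquare (NumberField.discr K).toNat := by
  rintro ⟨r, hr⟩
  have hfd := isFundamentalDiscriminant_discr (K := K) h2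
  have hdZ : NumberField.discr K = (r : ℤ) ^ 2 := by
    have : ((NumberField.discr K).toNat : ℤ) = NumberField.discr K := Int.toNat_of_nonneg hd.le
    rw [← this, hr]; push_cast; ring
  have hsq := sq_eq_one_or_four_of_sq_dvd hfd (x := r) (by rw [hdZ])
  rcases hfd with ⟨h1, -, hne⟩ | ⟨h4, hm, -⟩
  · rcases hsq with h | h
    · exact hne (by rw [hdZ, h])
    · rw [hdZ, h] at h1; norm_num at h1
  · rcases hsq with h | h
    · rw [hdZ, h] at h4; norm_num at h4
    · rw [hdZ, h] at hm; norm_num at hm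

/-- `d_K mod 4 ∈ {0, 1}` for the natural number `d_K > 0` (Stickelberger). [folklore] -/
theorem discr_toNat_mod_four (h2 : finrank ℚ K = 2) (hd : 0 < NumberField.discr K) :
    (NumberField.discr K).toNat % 4 = 0 ∨ (NumberField.discr K).toNat % 4 = 1 := by
  have h := discr_emod_four (K := K) h2
  have : ((NumberField.discr K).toNat : ℤ) = NumberField.discr K := Int.toNat_of_nonneg hd.le
  omega

section Bridge

variable (b : Basis (Fin 2) ℤ (𝓞 K)) (hb : b 0 = 1) {t m : ℤ}

/-- The unit `(G − tB)/2 + Bω` attached to a solution `G² − d_K B² = 4` (`d_K = t² + 4m`,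
`ω² = m + tω`), with inverse `(G + tB)/2 − Bω`. [cite: JacobsonWilliams2008, §4.3 (η = x + yω, (4.5)–(4.7))] -/
def unitOfSolPos (hω : b 1 * b 1 = (m : 𝓞 K) + (t : 𝓞 K) * b 1) {G B : ℤ} (hGt : 2 ∣ G - t * B)
    (h : G ^ 2 - (t ^ 2 + 4 * m) * B ^ 2 = 4) : (𝓞 K)ˣ where
  val := (((G - t * B) / 2 : ℤ) : 𝓞 K) + (B : 𝓞 K) * b 1
  inv := (((G + t * B) / 2 : ℤ) : 𝓞 K) - (B : 𝓞 K) * b 1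
  val_inv := by
    obtain ⟨x, hx⟩ := hGt
    have h1 : (G - t * B) / 2 = x := by omega
    have h2 : (G + t * B) / 2 = x + t * B := by omega
    have hG : G = 2 * x + t * B := by omega
    have h4 : 4 * (x * (x + t * B) - m * B ^ 2 - (1)) = 0 := by rw [hG] at h; linear_combination h
    have hxx : x * (x + t * B) - m * B ^ 2 = 1 := by
      rcases mul_eq_zero.mp h4 with h0 | h0
      · norm_num at h0
      · linarith
    rw [h1, h2]
    have : ((x * (x + t * B) - m * B ^ 2 : ℤ) : 𝓞 K) = 1 := by rw [hxx]; push_cast; rfl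
    push_cast at this ⊢
    linear_combination (-(B : 𝓞 K) ^ 2) * hω + this
  inv_val := by
    obtain ⟨x, hx⟩ := hGt
    have h1 : (G - t * B) / 2 = x := by omega
    have h2 : (G + t * B) / 2 = x + t * B := by omega
    have hG : G = 2 * x + t * B := by omega
    have h4 : 4 * (x * (x + t * B) - m * B ^ 2 - (1)) = 0 := by rw [hG] at h; linear_combination h
    have hxx : x * (x + t * B) - m * B ^ 2 = 1 := by
      rcases mul_eq_zero.mp h4 with h0 | h0
      · norm_num at h0
      · linarith
    rw [h1, h2]
    have : ((x * (x + t * B) - m * B ^ 2 : ℤ) : 𝓞 K) = 1 := by rw [hxx]; push_cast; rfl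
    push_cast at this ⊢
    linear_combination (-(B : 𝓞 K) ^ 2) * hω + this

/-- The unit `(G − tB)/2 + Bω` attached to a solution `G² − d_K B² = −4`, with inverse
`−(G + tB)/2 + Bω`. [cite: JacobsonWilliams2008, §4.3 (η = x + yω, (4.5)–(4.7))] -/
def unitOfSolNeg (hω : b 1 * b 1 = (m : 𝓞 K) + (t : 𝓞 K) * b 1) {G B : ℤ} (hGt : 2 ∣ G - t * B)
    (h : G ^ 2 - (t ^ 2 + 4 * m) * B ^ 2 = -4) : (𝓞 K)ˣ where
  val := (((G - t * B) / 2 : ℤ) : 𝓞 K) + (B : 𝓞 K) * b 1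
  inv := -((((G + t * B) / 2 : ℤ) : 𝓞 K) - (B : 𝓞 K) * b 1)
  val_inv := by
    obtain ⟨x, hx⟩ := hGt
    have h1 : (G - t * B) / 2 = x := by omega
    have h2 : (G + t * B) / 2 = x + t * B := by omega
    have hG : G = 2 * x + t * B := by omega
    have h4 : 4 * (x * (x + t * B) - m * B ^ 2 - (-1)) = 0 := by rw [hG] at h; linear_combination h
    have hxx : x * (x + t * B) - m * B ^ 2 = -1 := by
      rcases mul_eq_zero.mp h4 with h0 | h0
      · norm_num at h0
      · linarith
    rw [h1, h2]
    have : ((x * (x + t * B) - m * B ^ 2 : ℤ) : 𝓞 K) = -1 := by rw [hxx]; push_cast; rfl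
    push_cast at this ⊢
    linear_combination ((B : 𝓞 K) ^ 2) * hω - this
  inv_val := by
    obtain ⟨x, hx⟩ := hGt
    have h1 : (G - t * B) / 2 = x := by omega
    have h2 : (G + t * B) / 2 = x + t * B := by omega
    have hG : G = 2 * x + t * B := by omega
    have h4 : 4 * (x * (x + t * B) - m * B ^ 2 - (-1)) = 0 := by rw [hG] at h; linear_combination h
    have hxx : x * (x + t * B) - m * B ^ 2 = -1 := by
      rcases mul_eq_zero.mp h4 with h0 | h0
      · norm_num at h0
      · linarith
    rw [h1, h2]
    have : ((x * (x + t * B) - m * B ^ 2 : ℤ) : 𝓞 K) = -1 := by rw [hxx]; push_cast; rfl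
    push_cast at this ⊢
    linear_combination ((B : 𝓞 K) ^ 2) * hω - this

omit [NumberField K] in
/-- The real embeddings of `x + Bω` with `x = (G − tB)/2`: `σ(x + Bω) = (G + Bδ)/2` with
`δ = 2σ(ω) − t = ±√d_K`. [cite: JacobsonWilliams2008, §4.3 (η = (2x + yΔ + y√Δ)/2)] -/
theorem ringHom_intCast_add_mul (σ : K →+* ℝ) {G B t : ℤ} (hGt : 2 ∣ G - t * B) :
    σ ((((((G - t * B) / 2 : ℤ) : 𝓞 K) + (B : 𝓞 K) * b 1 : 𝓞 K) : K)) =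
      (G + B * (2 * σ (b 1 : K) - t)) / 2 := by
  obtain ⟨x, hx⟩ := hGt
  have h1 : (G - t * B) / 2 = x := by omega
  rw [h1]
  have hG : (G : ℝ) = 2 * x + t * B := by
    have : G = 2 * x + t * B := by omega
    exact_mod_cast this
  rw [hG]
  have : σ ((((x : 𝓞 K) + (B : 𝓞 K) * b 1 : 𝓞 K) : K)) = x + B * σ (b 1 : K) := by
    show σ (algebraMap (𝓞 K) K ((x : 𝓞 K) + (B : 𝓞 K) * b 1)) = _
    rw [map_add, map_mul, map_intCast, map_intCast, map_add, map_mul, map_intCast, map_intCast]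
  rw [this]
  ring

include hb in
/-- **`R_K = log ε`**: the regulator of a real quadratic field is the logarithm of the product
`ε = ∏_{k=1}^{p} φ_k` of the complete quotients over the principal cycle of `d_K`
(Jacobson–Williams' `R_Δ = log ε_Δ`, `ε_Δ = θ_{p+1} = ∏ φ_i`). [cite: JacobsonWilliams2008, §5.3 (p. 112 and (5.33)–(5.34))] -/
theorem regulator_eq_log_fundUnit (h2 : finrank ℚ K = 2) (hd : 0 < NumberField.discr K) :
    regulator K = Real.log (QuadIrr.fundUnit (NumberField.discr K).toNat) := by
  set t := b.repr (b 1 * b 1) 1 with ht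
  set m := b.repr (b 1 * b 1) 0 with hm
  have hω := basis_one_mul_self_eq b hb
  rw [← ht, ← hm] at hω
  have hdisc : NumberField.discr K = t ^ 2 + 4 * m := by rw [discr_eq_sq_add_four_mul b hb]
  set D : ℕ := (NumberField.discr K).toNat with hDdef
  have hDZ : (D : ℤ) = t ^ 2 + 4 * m := by rw [← hdisc]; exact Int.toNat_of_nonneg hd.le
  have hDR : ((t ^ 2 + 4 * m : ℤ) : ℝ) = (D : ℝ) := by rw [← hDZ]; rfl
  have hD : ¬ IsSquare D := not_isSquare_discr_toNat h2 hd
  have hD4 : D % 4 = 0 ∨ D % 4 = 1 := discr_toNat_mod_four h2 hd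
  obtain ⟨G, B, hG, hB, hGB, hε, hε'⟩ := QuadIrr.exists_fundUnit_eq hD hD4
  have hε1 := QuadIrr.one_lt_fundUnit hD hD4
  have hnorm := QuadIrr.fundUnit_mul_psiBarProd hD hD4
  rw [hε'] at hnorm
  -- parity `G ≡ tB (mod 2)`
  have hGt : 2 ∣ G - t * B := by
    refine QuadIrr.two_dvd_sub_mul (D := D) ⟨(t ^ 2 - t) / 2 + 2 * m, ?_⟩ ?_
    · have := QuadIrr.two_dvd_sq_sub_self t
      rw [hDZ]; omega
    · rcases hGB with h | h <;> rw [h] <;> norm_num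
  have hGB' : G ^ 2 - (t ^ 2 + 4 * m) * B ^ 2 = 4 ∨ G ^ 2 - (t ^ 2 + 4 * m) * B ^ 2 = -4 := by
    rwa [← hDZ]
  -- the unit and its embeddings
  have key : ∀ u : (𝓞 K)ˣ, (u : 𝓞 K) = (((G - t * B) / 2 : ℤ) : 𝓞 K) + (B : 𝓞 K) * b 1 →
      ∀ σ : K →+* ℝ, |Real.log (|σ ((u : 𝓞 K) : K)|)| = Real.log (QuadIrr.fundUnit D) := by
    intro u hu σ
    rw [hu, ringHom_intCast_add_mul b σ hGt]
    set δ : ℝ := 2 * σ (b 1 : K) - t with hδ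
    have hδ2 : δ ^ 2 = (D : ℝ) := by rw [← hDR]; exact ringHom_delta_sq b hω σ
    have hcases : δ = Real.sqrt D ∨ δ = -Real.sqrt D := by
      apply sq_eq_sq_iff_eq_or_eq_neg.mp
      rw [hδ2, QuadIrr.sqrt_sq]
    rcases hcases with h | h
    · rw [h, ← hε, abs_of_pos (show (0 : ℝ) < QuadIrr.fundUnit D by linarith), abs_of_pos (Real.log_pos hε1)]
    · rw [h, show ((G : ℝ) + B * -Real.sqrt D) / 2 = (G - B * Real.sqrt D) / 2 by ring]
      have hinv : ((G : ℝ) - B * Real.sqrt D) / 2 = (-1) ^ QuadIrr.periodLength D / QuadIrr.fundUnit D := by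
        rw [← hnorm]; field_simp
      rw [hinv, abs_div, abs_pow, abs_neg, abs_one, one_pow,
        abs_of_pos (show (0 : ℝ) < QuadIrr.fundUnit D by linarith),
        Real.log_div one_ne_zero (show QuadIrr.fundUnit D ≠ 0 by linarith), Real.log_one, zero_sub, abs_neg,
        abs_of_pos (Real.log_pos hε1)]
  -- minimality in the shape of `regulator_eq_log_of_minimal`
  have hmin : ∀ X Y : ℤ, 1 ≤ X → 1 ≤ Y →
      (X ^ 2 - (t ^ 2 + 4 * m) * Y ^ 2 = 4 ∨ X ^ 2 - (t ^ 2 + 4 * m) * Y ^ 2 = -4) →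
      QuadIrr.fundUnit D ≤ (X + Y * Real.sqrt ((t ^ 2 + 4 * m : ℤ) : ℝ)) / 2 := by
    intro X Y hX hY hXY
    rw [hDR]
    rw [← hDZ] at hXY
    exact QuadIrr.fundUnit_le hD hD4 hX hY hXY
  rcases hGB' with hpos | hneg
  · exact regulator_eq_log_of_minimal b hb h2 hd hω hε1 hmin (unitOfSolPos b hω hGt hpos)
      (key (unitOfSolPos b hω hGt hpos) rfl)
  · exact regulator_eq_log_of_minimal b hb h2 hd hω hε1 hmin (unitOfSolNeg b hω hGt hneg)
      (key (unitOfSolNeg b hω hGt hneg) rfl)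

end Bridge

/-- **`R_K = log ε_{d_K}`** (basis-free form). [cite: JacobsonWilliams2008, §5.3 (p. 112 and (5.33)–(5.34))] -/
theorem regulator_eq_log_fundUnit' (h2 : finrank ℚ K = 2) (hd : 0 < NumberField.discr K) :
    regulator K = Real.log (QuadIrr.fundUnit (NumberField.discr K).toNat) := by
  obtain ⟨b, hb⟩ := exists_basis_zero_eq_one h2
  exact regulator_eq_log_fundUnit b hb h2 hd

/-- **The regulator as the distance around the principal cycle**:
`R_K = ∑_{k<p} log φ(ρᵏ x₁)`, the sum of the logarithms of the complete quotients over one period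
of the principal cycle of `d_K` (each term the Shanks distance `δ(J, ρJ) = ln γ > 0`).
[cite: Jozsa2003, §6.3 Thm. 4(b) with §7 Prop. 31] -/
theorem regulator_eq_sum_log (h2 : finrank ℚ K = 2) (hd : 0 < NumberField.discr K) :
    regulator K = ∑ k ∈ Finset.range (QuadIrr.periodLength (NumberField.discr K).toNat),
      Real.log ((QuadIrr.step^[k] (QuadIrr.principalFirst (NumberField.discr K).toNat)).val) := by
  rw [regulator_eq_log_fundUnit' h2 hd,
    QuadIrr.log_fundUnit (not_isSquare_discr_toNat h2 hd) (discr_toNat_mod_four h2 hd)]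

end Literature.NumberTheory.QuadraticFields.Quadratic

end

noncomputable section

/-! ## The regulator of `ℚ(√d)` for squarefree `d`: the fundamental discriminant `fundDiscr d ∈ {d, 4d}`
and the least unit-solution (API of proposal p57716, restored)

The declarations below re-establish, with the same names and statements, the interface of the
file of the same path landed as p57716 (seat `…Ha-0dcf445cdb`, towards
`Hallgren2007_regulator_qsolvable_delim`), which proposal p60362 (this file's principal-cycle
bridge, towards `Hallgren2007_regulator_qsolvable`) replaced by accident on 2026-08-15 (two seats
chose the same file name; the whole-file protocol dropped the earlier, not yet referenced,
declarations). Restored: `fundDiscr`, `fundDiscr_of_mod_four_eq_one`, `fundDiscr_of_mod_four_ne_one`,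
`fundDiscr_pos`, `not_isSquare_of_squarefree`, `not_isSquare_intCast_of_squarefree`,
`not_isSquare_four_mul_of_squarefree`, `not_isSquare_fundDiscr`, `isFundamental_fundDiscr`,
`not_mem_range_of_sq_eq_natCast`, `discr_eq_fundDiscr`, `discr_pos_of_sq_eq_natCast`,
`exists_isLeast_unitSol`, `regulator_eq_log_of_sq_eq_natCast`, `exists_regulator_eq_log`
(the internal unit constructors `unitOfSqSubEq`/`abs_log_unitOfSqSubEq` of p57716 are subsumed by
`unitOfSolPos`/`unitOfSolNeg` above; the proofs of the two regulator statements now go through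
`regulator_eq_log_fundUnit'`). New in addition: `fundDiscr_toNat_mod_four`,
`fundUnit_eq_of_isLeast` and **`regulator_eq_log_fundUnit_fundDiscr`** /
**`regulator_eq_sum_log_fundDiscr`** — the bridge in terms of the input `d` of Hallgren's algorithm. -/

open Module NumberField NumberField.Units

namespace Literature.NumberTheory.QuadraticFields.Quadratic

/-- The (fundamental) discriminant of `ℚ(√d)`, `d` squarefree: `d` if `d ≡ 1 (mod 4)`, else `4d`
(Marcus, *Number Fields*, Ch. 2 Thm. 1; Jozsa 2003 §3, `D = d` or `4d`). [cite: Jozsa2003, §3 (Thm 2 and the definition of D)] -/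
def fundDiscr (d : ℕ) : ℤ := if d % 4 = 1 then (d : ℤ) else 4 * (d : ℤ)

/-- `fundDiscr d = d` when `d ≡ 1 (mod 4)`. [folklore] -/
theorem fundDiscr_of_mod_four_eq_one {d : ℕ} (h : d % 4 = 1) : fundDiscr d = d := by
  simp [fundDiscr, h]

/-- `fundDiscr d = 4d` when `d ≢ 1 (mod 4)`. [folklore] -/
theorem fundDiscr_of_mod_four_ne_one {d : ℕ} (h : d % 4 ≠ 1) : fundDiscr d = 4 * d := by
  simp [fundDiscr, h]

/-- `fundDiscr d > 0` for `d > 0`. [folklore] -/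
theorem fundDiscr_pos {d : ℕ} (hd : 0 < d) : 0 < fundDiscr d := by
  unfold fundDiscr; split_ifs <;> positivity

/-- `(fundDiscr d).toNat ≡ 0` or `1 (mod 4)`. [folklore] -/
theorem fundDiscr_toNat_mod_four (d : ℕ) : (fundDiscr d).toNat % 4 = 0 ∨ (fundDiscr d).toNat % 4 = 1 := by
  unfold fundDiscr
  split_ifs with h
  · right; rw [Int.toNat_natCast]; exact h
  · left
    rw [show (4 * (d : ℤ)) = ((4 * d : ℕ) : ℤ) by push_cast; ring, Int.toNat_natCast]
    omega

/-- A squarefree `d ≥ 2` is not a square. [folklore] -/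
theorem not_isSquare_of_squarefree {d : ℕ} (hsf : Squarefree d) (h2 : 2 ≤ d) : ¬ IsSquare d := by
  rintro ⟨r, hr⟩
  have hu : IsUnit r := hsf r ⟨1, by rw [hr, mul_one]⟩
  rw [Nat.isUnit_iff] at hu
  subst hu; omega

/-- A squarefree `d ≥ 2` is not a square in `ℤ`. [folklore] -/
theorem not_isSquare_intCast_of_squarefree {d : ℕ} (hsf : Squarefree d) (h2 : 2 ≤ d) :
    ¬ IsSquare (d : ℤ) := by
  rw [Int.isSquare_natCast_iff]; exact not_isSquare_of_squarefree hsf h2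

/-- `4d` is not a square in `ℤ` for squarefree `d ≥ 2`. [folklore] -/
theorem not_isSquare_four_mul_of_squarefree {d : ℕ} (hsf : Squarefree d) (h2 : 2 ≤ d) :
    ¬ IsSquare (4 * (d : ℤ)) := by
  rintro ⟨r, hr⟩
  have h2r : 2 ∣ r := by
    have : (2 : ℤ) ∣ r * r := ⟨2 * d, by rw [← hr]; ring⟩
    exact (Int.prime_two.dvd_mul.mp this).elim id id
  obtain ⟨s, rfl⟩ := h2r
  exact not_isSquare_intCast_of_squarefree hsf h2 ⟨s, by linarith⟩

/-- `fundDiscr d` is not a square for squarefree `d ≥ 2`. [folklore] -/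
theorem not_isSquare_fundDiscr {d : ℕ} (hsf : Squarefree d) (h2 : 2 ≤ d) :
    ¬ IsSquare (fundDiscr d) := by
  unfold fundDiscr; split_ifs
  · exact not_isSquare_intCast_of_squarefree hsf h2
  · exact not_isSquare_four_mul_of_squarefree hsf h2

/-- `(fundDiscr d).toNat` is not a square for squarefree `d ≥ 2`. [folklore] -/
theorem not_isSquare_fundDiscr_toNat {d : ℕ} (hsf : Squarefree d) (h2 : 2 ≤ d) :
    ¬ IsSquare (fundDiscr d).toNat := by
  rintro ⟨r, hr⟩
  refine not_isSquare_fundDiscr hsf h2 ⟨r, ?_⟩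
  rw [← Int.toNat_of_nonneg (fundDiscr_pos (d := d) (by omega)).le, hr]; push_cast; ring

/-- **`fundDiscr d` is a fundamental discriminant** (squarefree `d ≥ 2`): `d ≡ 1 (4)` squarefree, or
`4m` with `m = d ≡ 2, 3 (4)` squarefree. [cite: Jozsa2003, §3 (Thm 2)] -/
theorem isFundamental_fundDiscr {d : ℕ} (hsf : Squarefree d) (h2 : 2 ≤ d) :
    (fundDiscr d % 4 = 1 ∧ Squarefree (fundDiscr d) ∧ fundDiscr d ≠ 1) ∨
      (4 ∣ fundDiscr d ∧ (fundDiscr d / 4 % 4 = 2 ∨ fundDiscr d / 4 % 4 = 3) ∧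
        Squarefree (fundDiscr d / 4)) := by
  unfold fundDiscr
  split_ifs with h
  · left
    refine ⟨by exact_mod_cast h, by rwa [Int.squarefree_natCast], by exact_mod_cast (show d ≠ 1 by omega)⟩
  · right
    refine ⟨dvd_mul_right 4 _, ?_, ?_⟩
    · rw [Int.mul_ediv_cancel_left _ four_ne_zero]
      have h0 : d % 4 ≠ 0 := by
        intro h0
        have h4 : (2 * 2 : ℕ) ∣ d := by omega
        have := hsf 2 h4
        norm_num at this
      omega
    · rw [Int.mul_ediv_cancel_left _ four_ne_zero, Int.squarefree_natCast]; exact hsf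

variable {K : Type*} [Field K] [NumberField K]

/-- A square root of a squarefree `d ≥ 2` in `K` is irrational. [folklore] -/
theorem not_mem_range_of_sq_eq_natCast {d : ℕ} (hsf : Squarefree d) (h2 : 2 ≤ d) {α : K}
    (hα : α ^ 2 = (d : K)) : α ∉ Set.range (algebraMap ℚ K) := by
  rintro ⟨r, hr⟩
  have hr2 : (algebraMap ℚ K) (r ^ 2) = algebraMap ℚ K (d : ℚ) := by
    rw [map_pow, hr, hα, map_natCast]
  have hrd : r ^ 2 = (d : ℚ) := (algebraMap ℚ K).injective hr2
  have : IsSquare (d : ℚ) := ⟨r, by rw [← hrd, sq]⟩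
  rw [Rat.isSquare_natCast_iff] at this
  exact not_isSquare_of_squarefree hsf h2 this

/-- **The discriminant of a quadratic field containing `√d`, `d ≥ 2` squarefree, is `fundDiscr d`**
(Marcus Ch. 2 Thm. 1): `d_K = d q²` (`NumberField.exists_discr_eq_mul_sq`) and both `d_K` and
`fundDiscr d` are fundamental, hence equal (`eq_of_isFundamental_of_eq_mul_sq`). [cite: Jozsa2003, §3 (Thm 2)] -/
theorem discr_eq_fundDiscr (h2 : finrank ℚ K = 2) {d : ℕ} (hsf : Squarefree d) (h2d : 2 ≤ d)
    {α : K} (hα : α ^ 2 = (d : K)) : NumberField.discr K = fundDiscr d := by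
  have hθ := not_mem_range_of_sq_eq_natCast hsf h2d hα
  have hc : α ^ 2 = algebraMap ℚ K (d : ℚ) := by rw [hα, map_natCast]
  obtain ⟨q, hq, hdisc⟩ := NumberField.exists_discr_eq_mul_sq h2 hθ hc
  refine eq_of_isFundamental_of_eq_mul_sq (isFundamentalDiscriminant_discr h2)
    (isFundamental_fundDiscr hsf h2d) (q := if d % 4 = 1 then q else q / 2) ?_
  unfold fundDiscr
  split_ifs with h
  · exact hdisc
  · rw [hdisc]; push_cast; ring

/-- A quadratic field containing `√d`, `d ≥ 2` squarefree, is real quadratic: `d_K > 0`. [folklore] -/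
theorem discr_pos_of_sq_eq_natCast (h2 : finrank ℚ K = 2) {d : ℕ} (hsf : Squarefree d)
    (h2d : 2 ≤ d) {α : K} (hα : α ^ 2 = (d : K)) : 0 < NumberField.discr K := by
  rw [discr_eq_fundDiscr h2 hsf h2d hα]; exact fundDiscr_pos (by omega)

/-- **Existence of the least unit `> 1`.** For `D > 0` not a square, among the real numbers
`(X + Y√D)/2` with `X, Y ≥ 1` and `X² − D Y² = ±4` there is a least one, and it is `> 1`
(non-empty by Pell's equation, Mathlib `Pell.exists_of_not_isSquare`; discrete because
`X, Y ≤ 2v`). Jozsa 2003, §3 Thm 3 (`ε₀`, "the smallest unit greater than 1"). [cite: Jozsa2003, Thm 3] -/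
theorem exists_isLeast_unitSol {D : ℤ} (hD : 0 < D) (hsq : ¬ IsSquare D) :
    ∃ ε₀ : ℝ, 1 < ε₀ ∧
      (∃ X Y : ℤ, 1 ≤ X ∧ 1 ≤ Y ∧ (X ^ 2 - D * Y ^ 2 = 4 ∨ X ^ 2 - D * Y ^ 2 = -4) ∧
        ε₀ = (X + Y * Real.sqrt D) / 2) ∧
      ∀ X Y : ℤ, 1 ≤ X → 1 ≤ Y → (X ^ 2 - D * Y ^ 2 = 4 ∨ X ^ 2 - D * Y ^ 2 = -4) →
        ε₀ ≤ (X + Y * Real.sqrt D) / 2 := by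
  classical
  -- a first solution, from Pell's equation `x² − D y² = 1`
  obtain ⟨x, y, hxy, hy⟩ := Pell.exists_of_not_isSquare hD hsq
  set X₀ : ℤ := 2 * |x| with hX₀
  set Y₀ : ℤ := 2 * |y| with hY₀
  have hX₀1 : 1 ≤ X₀ := by
    have : x ≠ 0 := by rintro rfl; nlinarith [sq_nonneg y]
    have := abs_pos.mpr this; omega
  have hY₀1 : 1 ≤ Y₀ := by have := abs_pos.mpr hy; omega
  have hsol₀ : X₀ ^ 2 - D * Y₀ ^ 2 = 4 ∨ X₀ ^ 2 - D * Y₀ ^ 2 = -4 := by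
    left; rw [hX₀, hY₀]; nlinarith [sq_abs x, sq_abs y]
  -- the finitely many solutions below the first one
  have hsqrt : 0 ≤ Real.sqrt D := Real.sqrt_nonneg _
  have hD2 : (2 : ℤ) ≤ D := by
    by_contra h
    exact hsq ⟨1, by omega⟩
  have hsqrt1 : 1 < Real.sqrt D := by
    rw [show (1 : ℝ) = Real.sqrt 1 by simp]
    exact Real.sqrt_lt_sqrt zero_le_one (by exact_mod_cast (show (1 : ℤ) < D by omega))
  set v₀ : ℝ := (X₀ + Y₀ * Real.sqrt D) / 2 with hv₀
  set M : ℤ := X₀ + Y₀ * D with hM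
  have hMv : 2 * v₀ ≤ M := by
    rw [hv₀, hM]; push_cast
    have : Real.sqrt D ≤ D := by
      have h1 : (1 : ℝ) ≤ D := by exact_mod_cast hD
      nlinarith [Real.sq_sqrt (show (0:ℝ) ≤ D by positivity), Real.sqrt_nonneg (D : ℝ)]
    have hY : (0 : ℝ) ≤ Y₀ := by exact_mod_cast (show 0 ≤ Y₀ by omega)
    nlinarith
  set val : ℤ × ℤ → ℝ := fun XY => ((XY.1 : ℝ) + XY.2 * Real.sqrt D) / 2 with hval
  set T : Finset (ℤ × ℤ) := ((Finset.Icc 1 M) ×ˢ (Finset.Icc 1 M)).filter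
    (fun XY => XY.1 ^ 2 - D * XY.2 ^ 2 = 4 ∨ XY.1 ^ 2 - D * XY.2 ^ 2 = -4) with hT
  -- every solution of value `≤ v₀` lies in `T`
  have hmemT : ∀ X Y : ℤ, 1 ≤ X → 1 ≤ Y → (X ^ 2 - D * Y ^ 2 = 4 ∨ X ^ 2 - D * Y ^ 2 = -4) →
      val (X, Y) ≤ v₀ → (X, Y) ∈ T := by
    intro X Y hX hY hXY hle
    have hvX : (X : ℝ) ≤ 2 * val (X, Y) := by
      simp only [hval]
      have : (0:ℝ) ≤ Y := by exact_mod_cast (show 0 ≤ Y by omega)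
      nlinarith
    have hvY : (Y : ℝ) ≤ 2 * val (X, Y) := by
      simp only [hval]
      have hX0 : (0:ℝ) ≤ X := by exact_mod_cast (show 0 ≤ X by omega)
      have hY0 : (0:ℝ) ≤ Y := by exact_mod_cast (show 0 ≤ Y by omega)
      nlinarith
    have hXM : X ≤ M := by exact_mod_cast (show (X : ℝ) ≤ M by linarith)
    have hYM : Y ≤ M := by exact_mod_cast (show (Y : ℝ) ≤ M by linarith)
    simp only [hT, Finset.mem_filter, Finset.mem_product, Finset.mem_Icc]
    exact ⟨⟨⟨hX, hXM⟩, ⟨hY, hYM⟩⟩, hXY⟩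
  have h₀T : (X₀, Y₀) ∈ T := hmemT X₀ Y₀ hX₀1 hY₀1 hsol₀ le_rfl
  obtain ⟨⟨X₁, Y₁⟩, h₁T, hmin⟩ := Finset.exists_min_image T val ⟨_, h₀T⟩
  simp only [hT, Finset.mem_filter, Finset.mem_product, Finset.mem_Icc] at h₁T
  obtain ⟨⟨⟨hX₁, -⟩, ⟨hY₁, -⟩⟩, hsol₁⟩ := h₁T
  refine ⟨val (X₁, Y₁), ?_, ⟨X₁, Y₁, hX₁, hY₁, hsol₁, rfl⟩, fun X Y hX hY hXY => ?_⟩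
  · simp only [hval]
    have hX : (1:ℝ) ≤ X₁ := by exact_mod_cast hX₁
    have hY : (1:ℝ) ≤ Y₁ := by exact_mod_cast hY₁
    nlinarith
  · by_contra hlt
    push Not at hlt
    have hle : val (X, Y) ≤ v₀ := (hlt.trans_le (hmin _ h₀T)).le
    exact absurd (hmin _ (hmemT X Y hX hY hXY hle)) (not_le.mpr hlt)

/-- The least unit-solution is the fundamental unit of the principal cycle: for `D ≡ 0, 1 (mod 4)`
not a square, an `ε₀ > 1` of the form `(X + Y√D)/2`, `X² − DY² = ±4`, lying below every such value
with `X, Y ≥ 1`, equals `QuadIrr.fundUnit D`. [cite: JacobsonWilliams2008, §4.3 with §5.3 (5.33)] -/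
theorem fundUnit_eq_of_isLeast {D : ℕ} (hD : ¬ IsSquare D) (hD4 : D % 4 = 0 ∨ D % 4 = 1) {ε₀ : ℝ}
    (hε₀ : 1 < ε₀)
    (hsol : ∃ X Y : ℤ, (X ^ 2 - D * Y ^ 2 = 4 ∨ X ^ 2 - D * Y ^ 2 = -4) ∧
      ε₀ = (X + Y * Real.sqrt D) / 2)
    (hmin : ∀ X Y : ℤ, 1 ≤ X → 1 ≤ Y → (X ^ 2 - D * Y ^ 2 = 4 ∨ X ^ 2 - D * Y ^ 2 = -4) →
      ε₀ ≤ (X + Y * Real.sqrt D) / 2) :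
    QuadIrr.fundUnit D = ε₀ := by
  obtain ⟨G, B, hG, hB, hGB, hε, -⟩ := QuadIrr.exists_fundUnit_eq hD hD4
  refine le_antisymm ?_ (by rw [hε]; exact hmin G B hG hB hGB)
  obtain ⟨X, Y, hXY, rfl⟩ := hsol
  -- `X, Y ≥ 1` because `ε₀ > 1` and `|ε̄₀| = 1/ε₀ < 1`
  have hsD := Real.sq_sqrt (show (0 : ℝ) ≤ D by positivity)
  have hnorm : ((X : ℝ) + Y * Real.sqrt D) / 2 * ((X - Y * Real.sqrt D) / 2) = 1 ∨
      ((X : ℝ) + Y * Real.sqrt D) / 2 * ((X - Y * Real.sqrt D) / 2) = -1 := by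
    rcases hXY with h | h
    · left
      have : (X : ℝ) ^ 2 - D * Y ^ 2 = 4 := by exact_mod_cast h
      nlinarith
    · right
      have : (X : ℝ) ^ 2 - D * Y ^ 2 = -4 := by exact_mod_cast h
      nlinarith
  have hconj : |((X : ℝ) - Y * Real.sqrt D) / 2| < 1 := by
    have hpos : (0 : ℝ) < (X + Y * Real.sqrt D) / 2 := by linarith
    rcases hnorm with h | h
    · have : ((X : ℝ) - Y * Real.sqrt D) / 2 = (((X : ℝ) + Y * Real.sqrt D) / 2)⁻¹ :=
        eq_inv_of_mul_eq_one_right h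
      rw [this, abs_of_pos (inv_pos.mpr hpos)]
      exact inv_lt_one_of_one_lt₀ hε₀
    · have h1 : -(((X : ℝ) - Y * Real.sqrt D) / 2) = (((X : ℝ) + Y * Real.sqrt D) / 2)⁻¹ :=
        eq_inv_of_mul_eq_one_right (by rw [mul_neg, h, neg_neg])
      have : ((X : ℝ) - Y * Real.sqrt D) / 2 = -(((X : ℝ) + Y * Real.sqrt D) / 2)⁻¹ := by
        rw [← h1, neg_neg]
      rw [this, abs_neg, abs_of_pos (inv_pos.mpr hpos)]
      exact inv_lt_one_of_one_lt₀ hε₀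
  rw [abs_lt] at hconj
  have hX : 1 ≤ X := by
    have : (0 : ℝ) < X := by linarith
    exact_mod_cast this
  have hY : 1 ≤ Y := by
    have h0 : (0 : ℝ) < Y * Real.sqrt D := by linarith
    have : (0 : ℝ) < Y := pos_of_mul_pos_left h0 (Real.sqrt_nonneg _)
    exact_mod_cast this
  exact QuadIrr.fundUnit_le hD hD4 hX hY hXY

/-- **Jozsa's `R = ln ε₀` is Mathlib's regulator.** For a number field `K` of degree `2` containing a
square root of a squarefree `d ≥ 2`, and the least solution `ε₀ = (X + Y√D)/2 > 1` of
`X² − DY² = ±4` (`D = fundDiscr d`; least among the solutions with `X, Y ≥ 1`),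
Mathlib's `NumberField.Units.regulator K` equals `log ε₀`. Proof: `d_K = D` (`discr_eq_fundDiscr`),
`R_K = log (QuadIrr.fundUnit D)` (`regulator_eq_log_fundUnit'`) and `fundUnit D = ε₀`
(`fundUnit_eq_of_isLeast`). [cite: Jozsa2003, §3 (Thm 3 and the definition of the regulator)] -/
theorem regulator_eq_log_of_sq_eq_natCast (h2 : finrank ℚ K = 2) {d : ℕ} (hsf : Squarefree d)
    (h2d : 2 ≤ d) {α : K} (hα : α ^ 2 = (d : K)) {ε₀ : ℝ} (hε₀ : 1 < ε₀)
    (hsol : ∃ X Y : ℤ, (X ^ 2 - fundDiscr d * Y ^ 2 = 4 ∨ X ^ 2 - fundDiscr d * Y ^ 2 = -4) ∧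
      ε₀ = (X + Y * Real.sqrt (fundDiscr d)) / 2)
    (hmin : ∀ X Y : ℤ, 1 ≤ X → 1 ≤ Y →
      (X ^ 2 - fundDiscr d * Y ^ 2 = 4 ∨ X ^ 2 - fundDiscr d * Y ^ 2 = -4) →
      ε₀ ≤ (X + Y * Real.sqrt (fundDiscr d)) / 2) :
    regulator K = Real.log ε₀ := by
  have hdisc : NumberField.discr K = fundDiscr d := discr_eq_fundDiscr h2 hsf h2d hα
  have hdpos : 0 < NumberField.discr K := discr_pos_of_sq_eq_natCast h2 hsf h2d hα
  rw [regulator_eq_log_fundUnit' h2 hdpos, hdisc]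
  set D : ℕ := (fundDiscr d).toNat with hDdef
  have hDZ : (D : ℤ) = fundDiscr d := Int.toNat_of_nonneg (fundDiscr_pos (d := d) (by omega)).le
  have hDR : (fundDiscr d : ℝ) = (D : ℝ) := by rw [← hDZ]; rfl
  rw [hDR] at hsol hmin
  have hsol' : ∃ X Y : ℤ, (X ^ 2 - D * Y ^ 2 = 4 ∨ X ^ 2 - D * Y ^ 2 = -4) ∧
      ε₀ = (X + Y * Real.sqrt D) / 2 := by
    obtain ⟨X, Y, h, hε⟩ := hsol; exact ⟨X, Y, by rw [hDZ]; exact h, hε⟩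
  have hmin' : ∀ X Y : ℤ, 1 ≤ X → 1 ≤ Y → (X ^ 2 - D * Y ^ 2 = 4 ∨ X ^ 2 - D * Y ^ 2 = -4) →
      ε₀ ≤ (X + Y * Real.sqrt D) / 2 := fun X Y hX hY h => hmin X Y hX hY (by rw [← hDZ]; exact h)
  rw [fundUnit_eq_of_isLeast (not_isSquare_fundDiscr_toNat hsf h2d) (fundDiscr_toNat_mod_four d)
    hε₀ hsol' hmin']

/-- **The regulator of `ℚ(√d)`, existence form**: for `d ≥ 2` squarefree there is a real
`ε₀ > 1`, the least `(X + Y√D)/2` with `X, Y ≥ 1`, `X² − DY² = ±4`, `D = fundDiscr d`, and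
`regulator K = log ε₀` for every degree-`2` number field `K` containing `√d`.
[cite: Jozsa2003, §3 (Thm 3 and the definition of the regulator)] -/
theorem exists_regulator_eq_log {d : ℕ} (hsf : Squarefree d) (h2d : 2 ≤ d) :
    ∃ ε₀ : ℝ, 1 < ε₀ ∧
      (∃ X Y : ℤ, 1 ≤ X ∧ 1 ≤ Y ∧
        (X ^ 2 - fundDiscr d * Y ^ 2 = 4 ∨ X ^ 2 - fundDiscr d * Y ^ 2 = -4) ∧
        ε₀ = (X + Y * Real.sqrt (fundDiscr d)) / 2) ∧
      (∀ X Y : ℤ, 1 ≤ X → 1 ≤ Y →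
        (X ^ 2 - fundDiscr d * Y ^ 2 = 4 ∨ X ^ 2 - fundDiscr d * Y ^ 2 = -4) →
        ε₀ ≤ (X + Y * Real.sqrt (fundDiscr d)) / 2) ∧
      ∀ (K : Type*) [Field K] [NumberField K], finrank ℚ K = 2 →
        (∃ α : K, α ^ 2 = (d : K)) → regulator K = Real.log ε₀ := by
  obtain ⟨ε₀, hε₀, hsol, hmin⟩ :=
    exists_isLeast_unitSol (fundDiscr_pos (by omega)) (not_isSquare_fundDiscr hsf h2d)
  refine ⟨ε₀, hε₀, hsol, hmin, fun K _ _ h2 ⟨α, hα⟩ => ?_⟩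
  obtain ⟨X, Y, -, -, hXY, hε⟩ := hsol
  exact regulator_eq_log_of_sq_eq_natCast h2 hsf h2d hα hε₀ ⟨X, Y, hXY, hε⟩ hmin

/-- **The bridge in terms of Hallgren's input `d`.** For `K ⊇ ℚ` of degree `2` containing `√d`,
`d ≥ 2` squarefree: `R_K = log (QuadIrr.fundUnit D)` with `D = (fundDiscr d).toNat ∈ {d, 4d}`.
[cite: Jozsa2003, §3 with §6.3 Thm. 4(b)] -/
theorem regulator_eq_log_fundUnit_fundDiscr (h2 : finrank ℚ K = 2) {d : ℕ} (hsf : Squarefree d)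
    (h2d : 2 ≤ d) {α : K} (hα : α ^ 2 = (d : K)) :
    regulator K = Real.log (QuadIrr.fundUnit (fundDiscr d).toNat) := by
  rw [regulator_eq_log_fundUnit' h2 (discr_pos_of_sq_eq_natCast h2 hsf h2d hα),
    discr_eq_fundDiscr h2 hsf h2d hα]

/-- **The regulator of `ℚ(√d)` as the distance around the principal cycle of `D = fundDiscr d`**:
`R_K = ∑_{k<p} log φ(ρᵏ x₁)`. [cite: Jozsa2003, §6.3 Thm. 4(b) with §7 Prop. 31] -/
theorem regulator_eq_sum_log_fundDiscr (h2 : finrank ℚ K = 2) {d : ℕ} (hsf : Squarefree d)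
    (h2d : 2 ≤ d) {α : K} (hα : α ^ 2 = (d : K)) :
    regulator K = ∑ k ∈ Finset.range (QuadIrr.periodLength (fundDiscr d).toNat),
      Real.log ((QuadIrr.step^[k] (QuadIrr.principalFirst (fundDiscr d).toNat)).val) := by
  rw [regulator_eq_sum_log h2 (discr_pos_of_sq_eq_natCast h2 hsf h2d hα),
    discr_eq_fundDiscr h2 hsf h2d hα]

end Literature.NumberTheory.QuadraticFields.Quadratic

end
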